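import Summits.KontsevichZagierPeriods.KontsevichZagierPeriods.Theses.LevelPairing
import Summits.KontsevichZagierPeriods.KontsevichZagierPeriods.Theses.ScissorsTransport

/-!
# Route LevelPairing — the telescope: `summit ∧ NL-elimination ∧ slab-functoriality ∧ SlabInjective ⟹ SameDimRules12`

Support file for item stmt-KontsevichZagierPeriods-4695 (`LevelPairing.SameDimRules12`, "rule 3 is only padding")
and stmt-KontsevichZagierPeriods-4696 (`LevelPairing.SlabInjective`). The route's rationale asserts, informally,
"KontsevichZagierPeriods ∧ NewtonLeibnizElimination ∧ SlabInjective ⟹ SameDimRules12 (telescope)". This file makes that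
implication a kernel-checked theorem and exhibits the one hypothesis the informal argument uses silently: padding must be
FUNCTORIAL on rules 1a/1b/2 (the slab endomorphism `[s] ↦ [s.slab 0]` of `KZ.FormalRep` maps every rule-1a/1b/2 instance
into KZ₁₂ := closure (1a ∪ 1b ∪ 2)); it enters as the hypothesis `hC` and is a routine (M/L-sized) lemma about cylinders.

The argument (pure algebra on the free abelian group `FormalRep = ℤ[Σ n, IntegralRep n]`, graded by the dimension `n`):
* modulo `K = KZ₁₂`, the subgroup generated by the padding relations `[s.slab j] − [s]` is the RANGE of `σ − 1`, `σ` the slab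
  endomorphism (slabs at level `j` and `0` differ by one translation, a rule-2 instance: `of_slab_sub_of_slab_zero_mem`);
* so a difference `y = [r] − [r']` of two representations of ONE dimension `n` lying in closure (rules 1–2 ∪ slabs) satisfies
  `y ≡ σ m − m (mod K)` for some `m`; projecting to each degree (`K` is generated by homogeneous elements, `σ` raises the
  degree by one) gives `m_j ∈ K` for `j < n`, `y + m_n ∈ K`, `σ^k m_n ≡ m_{n+k}`, and `m` has finite support: `σ^k y ∈ K`;
* `SlabInjective` peels the `k` paddings off one at a time.
With `ScissorsTransport.NewtonLeibnizElimination` (stmt-2668: every Newton–Leibniz instance lies in closure (rules 1–2 ∪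
slabs)) this gives SAME-DIMENSION DESCENT (`sameDimDescent_of_telescope`: KZ-equivalent representations of one dimension are
KZ₁₂-equivalent; the difference form of `ScissorsAvatars.DestabilisedScissors`, stmt-4257, and `LevelPairing.Dim1IsRules12`,
stmt-4699, at `n = 1`), and with the summit, `LevelPairing.SameDimRules12` (`sameDimRules12_of_telescope`).

Sources: M. Kontsevich, D. Zagier, *Periods* (2001), §1.2 (rules (1)–(3)); the calculus is `KZCalculus.lean` /
`KZCalculusProofs.lean` (`IntegralRep.slab`). The telescope is the standard computation of the kernel of
`M_n → colim (M_0 → M_1 → ⋯)` for a directed system of abelian groups. Deliberately NOT here: the slab-functoriality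
lemma itself (hypothesis `hC`), and anything transcendental.
-/

noncomputable section

namespace Summit.KontsevichZagierPeriods.LevelPairing

open Set MeasureTheory MvPolynomial
open Literature.NumberTheory.Transcendental Literature.NumberTheory.Transcendental.KZ
open Summit.KontsevichZagierPeriods.KontsevichZagierPeriods (Theses.LevelPairing.SlabInjective
  Theses.LevelPairing.SameDimRules12 Theses.LevelPairing.Dim1IsRules12 Theses.ScissorsTransport.NewtonLeibnizElimination)

variable {n : ℕ}

/-- The generators of KZ₁₂: the rule-1a, 1b, 2 instances of the Kontsevich–Zagier calculus. [folklore] -/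
abbrev rules12 : Set FormalRep := domainAddRel ∪ integrandAddRel ∪ changeOfVariablesRel

/-- KZ₁₂ := closure (1a ∪ 1b ∪ 2), the Newton–Leibniz-free sub-calculus. [folklore] -/
abbrev kz12 : AddSubgroup FormalRep := AddSubgroup.closure rules12

/-- The padding relations `[s.slab j] − [s]` (verbatim the set in `ScissorsTransport.NewtonLeibnizElimination`). [folklore] -/
abbrev slabRels : Set FormalRep := {c | ∃ (n : ℕ) (r : IntegralRep n) (j : ℕ), c = of (r.slab j) - of r}

/-- The slab (padding) endomorphism `σ [s] = [s.slab 0]` of `FormalRep`. [folklore] -/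
def slabEnd : FormalRep →+ FormalRep :=
  FreeAbelianGroup.map (fun p : (Σ n, IntegralRep n) => (⟨p.1 + 1, p.2.slab 0⟩ : Σ n, IntegralRep n))

/-- The projection onto the degree-`j` part of `FormalRep` (free on `Σ n, IntegralRep n`, graded by `n`). [folklore] -/
def proj (j : ℕ) : FormalRep →+ FormalRep :=
  FreeAbelianGroup.lift (fun p : (Σ n, IntegralRep n) => if p.1 = j then (FreeAbelianGroup.of p : FormalRep) else 0)

/-! ### The slab endomorphism and the degree projections -/

/-- `σ [s] = [s.slab 0]`. [folklore] -/
@[simp] theorem slabEnd_of (s : IntegralRep n) : slabEnd (of s) = of (s.slab 0) :=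
  FreeAbelianGroup.map_of_apply _

/-- `π j [s] = [s]` if `s` has dimension `j`, else `0`. [folklore] -/
theorem proj_of (j : ℕ) (s : IntegralRep n) : proj j (of s) = if n = j then of s else 0 :=
  FreeAbelianGroup.lift_apply_of _ _

/-- `π (j+1) ∘ σ = σ ∘ π j`: padding raises the degree by one. [folklore] -/
theorem proj_succ_slabEnd (j : ℕ) (x : FormalRep) : proj (j + 1) (slabEnd x) = slabEnd (proj j x) := by
  induction x using FreeAbelianGroup.induction_on with
  | zero => simp
  | of p =>
    obtain ⟨k, s⟩ := p
    rw [show (FreeAbelianGroup.of ⟨k, s⟩ : FormalRep) = of s from rfl, slabEnd_of, proj_of, proj_of]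
    by_cases hk : k = j
    · subst hk; simp
    · rw [if_neg (by omega), if_neg hk, map_zero]
  | neg p ih => simp only [map_neg, ih]
  | add x y hx hy => simp only [map_add, hx, hy]

/-- `π 0 ∘ σ = 0`: nothing padded has degree `0`. [folklore] -/
theorem proj_zero_slabEnd (x : FormalRep) : proj 0 (slabEnd x) = 0 := by
  induction x using FreeAbelianGroup.induction_on with
  | zero => simp
  | of p =>
    obtain ⟨k, s⟩ := p
    rw [show (FreeAbelianGroup.of ⟨k, s⟩ : FormalRep) = of s from rfl, slabEnd_of, proj_of, if_neg (by omega)]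
  | neg p ih => rw [map_neg, map_neg, ih, neg_zero]
  | add x y hx hy => rw [map_add, map_add, hx, hy, add_zero]

/-- Finite support: every formal combination has bounded degree. [folklore] -/
theorem exists_proj_eq_zero (x : FormalRep) : ∃ N : ℕ, ∀ j, N < j → proj j x = 0 := by
  induction x using FreeAbelianGroup.induction_on with
  | zero => exact ⟨0, fun j _ => by simp⟩
  | of p =>
    obtain ⟨k, s⟩ := p
    refine ⟨k, fun j hj => ?_⟩
    rw [show (FreeAbelianGroup.of ⟨k, s⟩ : FormalRep) = of s from rfl, proj_of, if_neg (by omega)]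
  | neg p ih =>
    obtain ⟨N, hN⟩ := ih
    exact ⟨N, fun j hj => by rw [map_neg, hN j hj, neg_zero]⟩
  | add x y hx hy =>
    obtain ⟨N, hN⟩ := hx
    obtain ⟨N', hN'⟩ := hy
    exact ⟨max N N', fun j hj => by
      rw [map_add, hN j (lt_of_le_of_lt (le_max_left _ _) hj),
        hN' j (lt_of_le_of_lt (le_max_right _ _) hj), add_zero]⟩

/-- A difference of two representations of dimension `n` is homogeneous of degree `n`. [folklore] -/
theorem proj_of_sub_of (j : ℕ) (r r' : IntegralRep n) :
    proj j (of r - of r') = if n = j then of r - of r' else 0 := by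
  rw [map_sub, proj_of, proj_of]
  split_ifs <;> simp

/-- KZ₁₂ is a GRADED subgroup: each generator is homogeneous, so the degree projections preserve it. [folklore] -/
theorem proj_mem_kz12 (j : ℕ) {x : FormalRep} (hx : x ∈ kz12) : proj j x ∈ kz12 := by
  have hle : kz12 ≤ kz12.comap (proj j) := by
    rw [AddSubgroup.closure_le]
    intro c hc
    rw [SetLike.mem_coe, AddSubgroup.mem_comap]
    have hc' : c ∈ kz12 := AddSubgroup.subset_closure hc
    rcases hc with (⟨k, r, r₁, r₂, -, -, -, -, rfl⟩ | ⟨k, r, r₁, r₂, -, -, -, rfl⟩) |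
      ⟨k, r, r', Φ, Φ', -, -, -, -, -, rfl⟩
    · have e : proj j (of r - of r₁ - of r₂) = if k = j then of r - of r₁ - of r₂ else 0 := by
        rw [map_sub, proj_of_sub_of, proj_of]
        split_ifs <;> simp
      rw [e]; split_ifs
      · exact hc'
      · exact zero_mem _
    · have e : proj j (of r - of r₁ - of r₂) = if k = j then of r - of r₁ - of r₂ else 0 := by
        rw [map_sub, proj_of_sub_of, proj_of]
        split_ifs <;> simp
      rw [e]; split_ifs
      · exact hc'
      · exact zero_mem _
    · rw [proj_of_sub_of]; split_ifs
      · exact hc'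
      · exact zero_mem _
  exact hle hx

/-! ### Slabs at different levels differ by a translation (one rule-2 instance) -/

/-- `[r.slab j] − [r.slab 0]` is ONE change-of-variables instance: the translation `t ↦ t − j` of the last coordinate
(a `ℚ`-polynomial map, its own derivative the identity, Jacobian `1`). [Kontsevich–Zagier 2001, §1.2, rule (2)] [folklore] -/
theorem of_slab_sub_of_slab_zero_mem_changeOfVariablesRel (r : IntegralRep n) (j : ℕ) :
    of (r.slab j) - of (r.slab 0) ∈ changeOfVariablesRel := by
  -- the translation vector `v = -j · e_last`
  set v : Fin (n + 1) → ℝ := fun i => if i = Fin.last n then -(j : ℝ) else 0 with hv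
  have hv_cast : ∀ i : Fin n, v (Fin.castSucc i) = 0 := fun i => by
    simp [hv, (Fin.castSucc_lt_last i).ne]
  have hinit : ∀ z : Fin (n + 1) → ℝ, Fin.init (z + v) = Fin.init z := by
    intro z; funext i; simp [Fin.init, hv_cast]
  have hinit' : ∀ z : Fin (n + 1) → ℝ, Fin.init (z - v) = Fin.init z := by
    intro z; funext i; simp [Fin.init, hv_cast]
  have hlast : ∀ z : Fin (n + 1) → ℝ, (z + v) (Fin.last n) = z (Fin.last n) - j := by
    intro z; simp [hv, sub_eq_add_neg]
  have hlast' : ∀ z : Fin (n + 1) → ℝ, (z - v) (Fin.last n) = z (Fin.last n) + j := by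
    intro z; simp [hv]
  refine ⟨n + 1, r.slab j, r.slab 0, fun z => z + v, fun _ => ContinuousLinearMap.id ℝ _, ?_, ?_,
    fun x _ y _ h => add_right_cancel h, ?_, ?_, rfl⟩
  · -- `ℚ`-semialgebraic: a polynomial map with rational coefficients
    refine (isSemialgebraicMapOn_aeval (r.isSemialgebraic_slabDomain j)
      (fun i => X i + C (if i = Fin.last n then -(j : ℚ) else 0))).congr fun z _ => ?_
    funext i
    by_cases hi : i = Fin.last n <;> simp [hv, hi]
  · intro z _
    exact ((hasFDerivAt_id z).add_const v).hasFDerivWithinAt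
  · -- the image of the level-`j` slab is the level-`0` slab
    ext w
    simp only [IntegralRep.domain_slab, IntegralRep.slabDomain, mem_setOf_eq, mem_image, Nat.cast_zero, zero_add]
    constructor
    · rintro ⟨hw, h0, h1⟩
      refine ⟨w - v, ⟨?_, ?_, ?_⟩, sub_add_cancel w v⟩
      · rwa [hinit']
      · rw [hlast']; linarith
      · rw [hlast']; linarith
    · rintro ⟨z, ⟨hz, h0, h1⟩, rfl⟩
      refine ⟨?_, ?_, ?_⟩
      · rwa [hinit]
      · rw [hlast]; linarith
      · rw [hlast]; linarith
  · -- the integrand is unchanged and the Jacobian is `1`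
    intro x _
    simp [hinit, ContinuousLinearMap.det]

/-- Hence `[r.slab j] − [r.slab 0] ∈ KZ₁₂`. [folklore] -/
theorem of_slab_sub_of_slab_zero_mem_kz12 (r : IntegralRep n) (j : ℕ) : of (r.slab j) - of (r.slab 0) ∈ kz12 :=
  AddSubgroup.subset_closure (Or.inr (of_slab_sub_of_slab_zero_mem_changeOfVariablesRel r j))

/-! ### Modulo KZ₁₂, the padding relations generate the range of `σ − 1` -/

/-- If `y` lies in closure (rules 1–2 ∪ slabs) then `y ≡ σ m − m (mod KZ₁₂)` for some formal combination `m`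
(the range of the endomorphism `σ − 1` is a subgroup). [folklore] -/
theorem exists_sub_slabEnd_sub_mem_kz12 {y : FormalRep} (hy : y ∈ AddSubgroup.closure (rules12 ∪ slabRels)) :
    ∃ m : FormalRep, y - (slabEnd m - m) ∈ kz12 := by
  induction hy using AddSubgroup.closure_induction with
  | mem c hc =>
    rcases hc with hc | ⟨k, r, j, rfl⟩
    · exact ⟨0, by simpa using (AddSubgroup.subset_closure hc : c ∈ kz12)⟩
    · refine ⟨of r, ?_⟩
      have e : of (r.slab j) - of r - (slabEnd (of r) - of r) = of (r.slab j) - of (r.slab 0) := by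
        rw [slabEnd_of]; abel
      rw [e]
      exact of_slab_sub_of_slab_zero_mem_kz12 r j
  | zero => exact ⟨0, by simp⟩
  | add x y _ _ hx hy =>
    obtain ⟨m, hm⟩ := hx
    obtain ⟨m', hm'⟩ := hy
    refine ⟨m + m', ?_⟩
    have e : x + y - (slabEnd (m + m') - (m + m')) = (x - (slabEnd m - m)) + (y - (slabEnd m' - m')) := by
      rw [map_add]; abel
    rw [e]
    exact add_mem hm hm'
  | neg x _ hx =>
    obtain ⟨m, hm⟩ := hx
    refine ⟨-m, ?_⟩
    have e : -x - (slabEnd (-m) - -m) = -(x - (slabEnd m - m)) := by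
      rw [map_neg]; abel
    rw [e]
    exact neg_mem hm

/-- **Peeling**: under `SlabInjective`, a same-dimension difference some padding of which lies in KZ₁₂ lies in KZ₁₂.
[folklore] -/
theorem of_sub_of_mem_kz12_of_iterate (hI : Theses.LevelPairing.SlabInjective) :
    ∀ (k : ℕ) {n : ℕ} (r r' : IntegralRep n), slabEnd^[k] (of r - of r') ∈ kz12 → of r - of r' ∈ kz12 := by
  intro k
  induction k with
  | zero => intro n r r' h; simpa using h
  | succ k ih =>
    intro n r r' h
    rw [Function.iterate_succ_apply, map_sub, slabEnd_of, slabEnd_of] at h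
    exact hI r r' (ih (r.slab 0) (r'.slab 0) h)

section Functorial

-- HYPOTHESIS `hC` (slab-functoriality of rules 1–2): the slab endomorphism maps every rule-1a/1b/2 instance into
-- KZ₁₂. Stated verbatim over `FreeAbelianGroup.map`, so that it can be filed as a route item without reference to this file.
variable (hC : ∀ c ∈ domainAddRel ∪ integrandAddRel ∪ changeOfVariablesRel,
    FreeAbelianGroup.map (fun p : (Σ n, IntegralRep n) => (⟨p.1 + 1, p.2.slab 0⟩ : Σ n, IntegralRep n)) c ∈
      AddSubgroup.closure (domainAddRel ∪ integrandAddRel ∪ changeOfVariablesRel))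
include hC

/-- Under `hC`, `σ` preserves KZ₁₂. [folklore] -/
theorem slabEnd_mem_kz12 {x : FormalRep} (hx : x ∈ kz12) : slabEnd x ∈ kz12 := by
  have hle : kz12 ≤ kz12.comap slabEnd := by
    rw [AddSubgroup.closure_le]
    intro c hc
    exact hC c hc
  exact hle hx

/-- Under `hC`, every iterate of `σ` preserves KZ₁₂. [folklore] -/
theorem iterate_slabEnd_mem_kz12 (k : ℕ) {x : FormalRep} (hx : x ∈ kz12) : slabEnd^[k] x ∈ kz12 := by
  induction k with
  | zero => simpa using hx
  | succ k ih =>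
    rw [Function.iterate_succ_apply']
    exact slabEnd_mem_kz12 hC ih

/-- **The telescope.** If `y` is homogeneous of degree `n` and `y ≡ σ m − m (mod KZ₁₂)`, then some padding `σ^k y`
lies in KZ₁₂: projecting to degrees gives `π_j m ∈ K` for `j < n`, `y + π_n m ∈ K`, `σ^k (π_n m) ≡ π_{n+k} m`, and `m`
has bounded degree. (The kernel of `M_n → colim_k M_{n+k}` for the system `σ : M_k → M_{k+1}`, `M = FormalRep ⧸ K`.)
[folklore] -/
theorem exists_iterate_slabEnd_mem_kz12 {y m : FormalRep} (hn : proj n y = y) (hj : ∀ j, j ≠ n → proj j y = 0)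
    (hm : y - (slabEnd m - m) ∈ kz12) : ∃ k : ℕ, slabEnd^[k] y ∈ kz12 := by
  -- degree-wise consequences of `hm`
  have H : ∀ j, proj j y - (proj j (slabEnd m) - proj j m) ∈ kz12 := fun j => by
    simpa only [map_sub] using proj_mem_kz12 j hm
  have H0 : proj 0 y + proj 0 m ∈ kz12 := by
    have h := H 0
    rwa [proj_zero_slabEnd, zero_sub, sub_neg_eq_add] at h
  have HS : ∀ i, proj (i + 1) y - slabEnd (proj i m) + proj (i + 1) m ∈ kz12 := fun i => by
    have h := H (i + 1)
    rwa [proj_succ_slabEnd, ← sub_add] at h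
  -- (1) below degree `n`, `m` dies in `K`
  have low : ∀ i, i < n → proj i m ∈ kz12 := by
    intro i
    induction i with
    | zero =>
      intro h0
      have h := H0
      rwa [hj 0 (by omega), zero_add] at h
    | succ i ih =>
      intro hi
      have h := HS i
      rw [hj (i + 1) (by omega), zero_sub] at h
      have h' := add_mem h (slabEnd_mem_kz12 hC (ih (by omega)))
      rwa [neg_add_cancel_comm] at h'
  -- (2) in degree `n`, `y + m_n ∈ K`
  have mid : y + proj n m ∈ kz12 := by
    rcases Nat.eq_zero_or_pos n with rfl | hpos
    · rw [← hn]; exact H0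
    · obtain ⟨i, rfl⟩ : ∃ i, n = i + 1 := ⟨n - 1, by omega⟩
      have h := HS i
      rw [hn] at h
      have h' := add_mem h (slabEnd_mem_kz12 hC (low i (by omega)))
      have e : y - slabEnd (proj i m) + proj (i + 1) m + slabEnd (proj i m) = y + proj (i + 1) m := by abel
      rwa [e] at h'
  -- (3) above degree `n`, `σ^k m_n ≡ m_{n+k}`
  have high : ∀ k, slabEnd^[k] (proj n m) - proj (n + k) m ∈ kz12 := by
    intro k
    induction k with
    | zero => simp
    | succ k ih =>
      have h := HS (n + k)
      rw [hj (n + k + 1) (by omega), zero_sub] at h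
      have h' := sub_mem (slabEnd_mem_kz12 hC ih) h
      have e : slabEnd (slabEnd^[k] (proj n m) - proj (n + k) m) - (-slabEnd (proj (n + k) m) + proj (n + k + 1) m) =
          slabEnd^[k + 1] (proj n m) - proj (n + (k + 1)) m := by
        rw [map_sub, Function.iterate_succ_apply', show n + (k + 1) = n + k + 1 from rfl]; abel
      rwa [e] at h'
  -- (4) `m` has bounded degree
  obtain ⟨N, hN⟩ := exists_proj_eq_zero m
  refine ⟨N + 1, ?_⟩
  have h1 : slabEnd^[N + 1] (proj n m) ∈ kz12 := by
    simpa [hN (n + (N + 1)) (by omega)] using high (N + 1)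
  have h2 : slabEnd^[N + 1] (y + proj n m) ∈ kz12 := iterate_slabEnd_mem_kz12 hC (N + 1) mid
  rw [iterate_map_add] at h2
  simpa using sub_mem h2 h1

/-- **Same-dimension descent** (the difference form of `ScissorsAvatars.DestabilisedScissors`, and of the route's informal
`SameDimIsRules12`): under NL-elimination, slab-functoriality and `SlabInjective`, KZ-EQUIVALENT representations of ONE
dimension are KZ₁₂-equivalent — no Newton–Leibniz move, no change of dimension. [folklore] -/
theorem sameDimDescent_of_telescope (hN : Theses.ScissorsTransport.NewtonLeibnizElimination)
    (hI : Theses.LevelPairing.SlabInjective) {n : ℕ} (r r' : IntegralRep n) (h : Equivalent r r') :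
    of r - of r' ∈ AddSubgroup.closure (domainAddRel ∪ integrandAddRel ∪ changeOfVariablesRel) := by
  -- NL-elimination: relations ≤ closure (rules 1–2 ∪ slabs)
  have hle : relations ≤ AddSubgroup.closure (rules12 ∪ slabRels) := by
    rw [relations, AddSubgroup.closure_le]
    rintro c (hc | hc)
    · exact AddSubgroup.subset_closure (Or.inl hc)
    · refine AddSubgroup.closure_mono ?_ (hN c hc)
      rintro d (hd | hd)
      · exact Or.inl hd
      · exact Or.inr hd
  obtain ⟨m, hm⟩ := exists_sub_slabEnd_sub_mem_kz12 (hle h)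
  obtain ⟨k, hk⟩ := exists_iterate_slabEnd_mem_kz12 hC (n := n)
    (by rw [proj_of_sub_of, if_pos rfl]) (fun j hj => by rw [proj_of_sub_of, if_neg (Ne.symm hj)]) hm
  exact of_sub_of_mem_kz12_of_iterate hI k r r' hk

/-- Item `LevelPairing.Dim1IsRules12` (stmt-4699) under the same three structural hypotheses (the route's line (i)).
[folklore] -/
theorem dim1IsRules12_of_telescope (hN : Theses.ScissorsTransport.NewtonLeibnizElimination)
    (hI : Theses.LevelPairing.SlabInjective) : Theses.LevelPairing.Dim1IsRules12 :=
  fun r r' h => sameDimDescent_of_telescope hC hN hI r r' h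

/-- **The route's telescope, kernel-checked**: summit ∧ NL-elimination ∧ slab-functoriality ∧ SlabInjective ⟹
`SameDimRules12` ("rule 3 is only padding"). The summit enters only to turn equal values into ONE KZ-equivalence; everything
else is transcendence-free. [folklore] -/
theorem sameDimRules12_of_telescope (hS : _root_.KontsevichZagierPeriods)
    (hN : Theses.ScissorsTransport.NewtonLeibnizElimination) (hI : Theses.LevelPairing.SlabInjective) :
    Theses.LevelPairing.SameDimRules12 :=
  fun _ r r' hr hr' hv => sameDimDescent_of_telescope hC hN hI r r' (hS r r' hr hr' hv)

end Functorial

end Summit.KontsevichZagierPeriods.LevelPairing
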